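import Literature.MathematicalPhysics.QuantumFieldTheory.OSTimeContinuation
import Literature.MathematicalPhysics.QuantumLattice.SchwingerWightmanBoundaryValueProofs
import Literature.Analysis.Complex.HolomorphicParametricIntegral
import HarnessLib

/-!
# Uniqueness of time-ray boundary values on the time tube ((D) of `OSTimeContinuation`, proved)

`Literature.MathematicalPhysics.QuantumFieldTheory.OSTimeContinuation` decomposes the analytic
core (A₁₂) `OS1975_exists_forwardTube_continuation` of the Osterwalder–Schrader reconstruction
theorem into the named facts (A1), (A2), (B), (D). This file **proves (D)**
`eqOn_timeTube_of_timeRayBoundaryValue` (`eqOn_timeTube_of_timeRayBoundaryValue_holds`): two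
functions continuous on the time tube `{Im z⃗_k = 0, Im (z⁰_k − z⁰_{k-1}) > 0}`, holomorphic in the
`n` complex times, with the same tempered time-ray boundary value coincide — Streater–Wightman
(1964), Thm. 2-17 / Hörmander, *ALPDO I*, Thm. 3.1.15 ("if the boundary value vanishes the
function vanishes") in the time variables. The tree's proof of the forward-tube case
(`Literature.MathematicalPhysics.QuantumLattice.eq_zero_of_rayBoundaryValue_zero`,
`SchwingerWightmanBoundaryValueProofs`: Banach–Steinhaus on `𝓓_K`, continuity across the real
axis, Painlevé, identity theorem) uses holomorphy on the forward tube in exactly two places —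
continuity of `x ↦ G(x + λη)` and holomorphy of the smeared ray function
`λ ↦ ∫ G(x + λη) φ(x) dx` — and both hold for a function which is merely continuous on the time
tube and holomorphic in the times, *provided the direction `η` is temporal* (the complex ray
`x + λη` then stays in the time tube, and the smeared ray function is a dominated parameter
integral of a holomorphic family, `Literature.Analysis.Complex.differentiableOn_integral_of_dominated`,
the majorant coming from continuity on the compact family of rays; no derivative bound is
needed). Through every point `z = x + iy` of the time tube passes such a ray (`y = Im z` is
temporal), whence the theorem:

* `integral_rayC_I_mul_eq_zero_of_continuous` — the core of the tree's proof with the two uses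
  of holomorphy turned into hypotheses (same proof);
* `rayC_mem_timeTube`, `differentiableOn_comp_rayC_of_isTimeHolomorphicOn`,
  `differentiableAt_integral_rayC_of_isTimeHolomorphicOn` — the two hypotheses for
  time-holomorphic functions and temporal directions;
* `eq_zero_of_timeRayBoundaryValue_zero`, **`eqOn_timeTube_of_timeRayBoundaryValue_holds`**;
* the assemblies of `OSTimeContinuation` with (D) discharged:
  `OS1975_exists_continuation_halfSpace_of_timeContinuation'`,
  `OS1975_exists_forwardTube_continuation_of_timeContinuation'` ((A1) → (A2) → (B) → (A₁₂)),
  `os_reconstruction_of_timeContinuation'`.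

## References

* R. F. Streater, A. S. Wightman, *PCT, Spin and Statistics, and All That* (1964), Thm. 2-17.
  [StreaterWightman1964]
* L. Hörmander, *The Analysis of Linear Partial Differential Operators I*, Thm. 3.1.15.
  [HormanderALPDO1]
* K. Osterwalder, R. Schrader, Comm. Math. Phys. 42 (1975), §IV.2. [OsterwalderSchraderCMP1975]
-/

noncomputable section

open Filter Topology Complex MeasureTheory Set ContDiffMapSupportedIn
open scoped SchwartzMap Distributions BoundedContinuousFunction ContDiff NNReal
open Literature.MathematicalPhysics.QuantumLattice
open Literature.MathematicalPhysics.QuantumLattice.ContDiffMapSupportedIn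

namespace Literature.MathematicalPhysics.QuantumFieldTheory

variable {d n : ℕ}

/-! ### The core of Hörmander's proof of Thm. 3.1.15, for a general ray family -/

/-- **The core of the uniqueness theorem, abstract form.** Let `G` be a function on complex
configurations and `η` a real direction such that (i) `x ↦ G(x + λη)` is continuous for
`Im λ > 0`, (ii) for every continuous compactly supported `φ` the smeared ray function
`λ ↦ ∫ G(x + λη) φ(x) dx` is complex differentiable on `Im λ > 0`, and (iii) all ray boundary
values of `G` in the direction `η` vanish on compactly supported test functions. Then
`∫ G(x + iη) φ(x) dx = 0` for every smooth compactly supported `φ`. This is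
`Literature.MathematicalPhysics.QuantumLattice.integral_rayC_I_mul_eq_zero` with its two uses of
holomorphy on the forward tube ((i) and (ii)) turned into hypotheses; the proof is the same
(Hörmander, proof of Thm. 3.1.15: Banach–Steinhaus on `𝓓_K`, continuity across the real axis,
Painlevé, identity theorem). [cite: HormanderALPDO1, Thm 3.1.15] -/
theorem integral_rayC_I_mul_eq_zero_of_continuous {G : (Fin n → Fin (d + 1) → ℂ) → ℂ}
    {η : Fin n → SpaceTime d}
    (hGc : ∀ {l : ℂ}, 0 < l.im → Continuous fun x : Fin n → SpaceTime d => G (rayC x η l))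
    (hGd : ∀ {φ : (Fin n → SpaceTime d) → ℂ}, Continuous φ → HasCompactSupport φ →
      ∀ {l₀ : ℂ}, 0 < l₀.im → DifferentiableAt ℂ (fun l => ∫ x, G (rayC x η l) * φ x) l₀)
    (hlim : ∀ F : 𝓢((Fin n → SpaceTime d), ℂ), HasCompactSupport (F : (Fin n → SpaceTime d) → ℂ) →
      Tendsto (fun t : ℝ => ∫ x, G (rayC x η ((t : ℂ) * I)) * F x) (𝓝[>] 0) (𝓝 0))
    {φ : (Fin n → SpaceTime d) → ℂ} (hφ : ContDiff ℝ ∞ φ) (hφc : HasCompactSupport φ) :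
    ∫ x, G (rayC x η I) * φ x = 0 := by
  -- the compact set carrying all translates of `φ`
  obtain ⟨R, hR⟩ := hφc.isCompact.isBounded.subset_closedBall 0
  let K : TopologicalSpace.Compacts (Fin n → SpaceTime d) :=
    ⟨Metric.closedBall 0 (R + ‖η‖), isCompact_closedBall 0 _⟩
  have hIt : ∀ {t : ℝ}, 0 < t → 0 < ((t : ℂ) * I).im := fun ht => by simpa using ht
  -- the family of distributions `Λ_t = G(· + i t η)`, `t > 0`
  let Λ : ℝ → 𝓓_{K}((Fin n → SpaceTime d), ℂ) →L[ℝ] ℂ := fun t =>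
    if ht : 0 < t then
      integralTestCLM (fun x => G (rayC x η ((t : ℂ) * I))) (hGc (hIt ht)) K volume
    else 0
  have hΛ : ∀ {t : ℝ}, 0 < t → ∀ ψ : 𝓓_{K}((Fin n → SpaceTime d), ℂ),
      Λ t ψ = ∫ x, G (rayC x η ((t : ℂ) * I)) * ψ x := by
    intro t ht ψ
    simp only [Λ, dif_pos ht]
    exact integralTestCLM_apply _ _ _ _ _
  -- pointwise convergence to `0`
  have hΛlim : ∀ ψ : 𝓓_{K}((Fin n → SpaceTime d), ℂ),
      Tendsto (fun t => Λ t ψ) (𝓝[>] 0) (𝓝 0) := by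
    intro ψ
    have h := hlim (ψ.compact_supp.toSchwartzMap ψ.contDiff) ψ.compact_supp
    refine h.congr' ?_
    filter_upwards [self_mem_nhdsWithin] with t ht
    exact (hΛ ht ψ).symm
  -- pointwise boundedness on `(0, 2]`
  have hbdd : ∀ ψ : 𝓓_{K}((Fin n → SpaceTime d), ℂ), ∃ C, ∀ t ∈ Ioc (0 : ℝ) 2, ‖Λ t ψ‖ ≤ C := by
    intro ψ
    refine exists_bound_of_continuousOn_of_tendsto ?_ (hΛlim ψ)
    have hΦψ : ∀ t : ℝ, 0 < t →
        ContinuousAt (fun t : ℝ => ∫ x, G (rayC x η ((t : ℂ) * I)) * ψ x) t := by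
      intro t ht
      have hd := hGd ψ.continuous ψ.compact_supp (hIt ht)
      exact hd.continuousAt.comp (f := fun t : ℝ => (t : ℂ) * I)
        (by fun_prop : Continuous fun t : ℝ => (t : ℂ) * I).continuousAt
    intro t ht
    refine ((hΦψ t ht.1).congr ?_).continuousWithinAt
    filter_upwards [(isOpen_lt continuous_const continuous_id).mem_nhds ht.1] with t' ht'
    exact (hΛ ht' ψ).symm
  -- the uniform boundedness principle
  obtain ⟨m, C, hC0, hC⟩ := exists_supSeminorm_bound Λ 2 hbdd
  -- the translates of `φ`
  let τ : ℝ → 𝓓_{K}((Fin n → SpaceTime d), ℂ) := ContDiffMapSupportedIn.translateTest hφ hR η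
  have hτc : Continuous τ := continuous_translateTest hφ hφc hR η
  -- the smeared ray function, its values through the family, its holomorphy
  let Φ : ℂ → ℂ := fun l => ∫ x, G (rayC x η l) * φ x
  have hΦΛ : ∀ {l : ℂ}, 0 < l.im → |l.re| ≤ 1 → Φ l = Λ l.im (τ l.re) := by
    intro l hl hre
    rw [hΛ hl]
    have h := integral_rayC_re_add_im (G := G) (η := η) (hGc (hIt hl)) hφ hR hre (t := l.im)
    rw [integralTestCLM_apply] at h
    simp only [re_add_im] at h
    exact h
  have hΦd : ∀ {l : ℂ}, 0 < l.im → DifferentiableAt ℂ Φ l :=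
    fun hl => hGd hφ.continuous hφc hl
  -- the glued function and the domain
  let g : ℂ → ℂ := fun l => if 0 < l.im then Φ l else 0
  let U : Set ℂ := (re ⁻¹' Ioo (-1 : ℝ) 1) ∩ (im ⁻¹' Iio 2)
  have hUo : IsOpen U :=
    (isOpen_Ioo.preimage continuous_re).inter (isOpen_Iio.preimage continuous_im)
  have hUc : Convex ℝ U :=
    ((convex_Ioo (-1 : ℝ) 1).linear_preimage reLm).inter ((convex_Iio (2 : ℝ)).linear_preimage imLm)
  have hopen_pos : IsOpen {l : ℂ | 0 < l.im} := isOpen_lt continuous_const continuous_im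
  have hopen_neg : IsOpen {l : ℂ | l.im < 0} := isOpen_lt continuous_im continuous_const
  have hg_pos : ∀ {l : ℂ}, 0 < l.im → g =ᶠ[𝓝 l] Φ := fun hl =>
    Filter.eventually_of_mem (hopen_pos.mem_nhds hl) fun l' hl' => if_pos hl'
  have hg_neg : ∀ {l : ℂ}, l.im < 0 → g =ᶠ[𝓝 l] fun _ => 0 := fun hl =>
    Filter.eventually_of_mem (hopen_neg.mem_nhds hl) fun l' (hl' : l'.im < 0) =>
      if_neg (not_lt.2 hl'.le)
  -- continuity of the glued function on `U`
  have hgc : ContinuousOn g U := by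
    intro l₀ hl₀
    rcases lt_trichotomy l₀.im 0 with hneg | hzero | hpos
    · exact (continuousAt_const.congr (hg_neg hneg).symm).continuousWithinAt
    · -- a real point of `U`
      set s₀ := l₀.re with hs₀
      have hs₀mem : s₀ ∈ Ioo (-1 : ℝ) 1 := hl₀.1
      rw [Metric.continuousWithinAt_iff]
      intro ε hε
      -- (ii) the pointwise limit at the translate `τ s₀`
      have h2 : ∀ᶠ t in 𝓝[>] (0 : ℝ), ‖Λ t (τ s₀)‖ < ε / 2 := by
        have := (Metric.tendsto_nhds.1 (hΛlim (τ s₀))) (ε / 2) (half_pos hε)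
        simpa [dist_zero_right] using this
      rw [eventually_nhdsWithin_iff, Metric.eventually_nhds_iff] at h2
      obtain ⟨δ₁, hδ₁, hδ₁'⟩ := h2
      -- (i) continuity of the translates in the `C^m` seminorm
      let q := ContDiffMapSupportedIn.supSeminorm ℝ (Fin n → SpaceTime d) ℂ ⊤ K m
      have hq : Continuous q :=
        (ContDiffMapSupportedIn.withSeminorms' ℝ (Fin n → SpaceTime d) ℂ ⊤ K).continuous_seminorm m
      have h1 : Tendsto (fun s => C * q (τ s - τ s₀)) (𝓝 s₀) (𝓝 0) := by
        have hτ0 : Tendsto (fun s => τ s - τ s₀) (𝓝 s₀) (𝓝 0) := by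
          have hc' : Continuous fun s => τ s - τ s₀ := hτc.sub continuous_const
          have h := hc'.tendsto s₀
          rwa [sub_self] at h
        have := ((hq.tendsto 0).comp hτ0).const_mul C
        simpa [map_zero] using this
      have h1' : ∀ᶠ s in 𝓝 s₀, C * q (τ s - τ s₀) < ε / 2 := by
        have := (Metric.tendsto_nhds.1 h1) (ε / 2) (half_pos hε)
        filter_upwards [this] with s hs
        rwa [Real.dist_eq, sub_zero, abs_of_nonneg (mul_nonneg hC0 (apply_nonneg q _))] at hs
      rw [Metric.eventually_nhds_iff] at h1'
      obtain ⟨δ₂, hδ₂, hδ₂'⟩ := h1'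
      obtain ⟨δ₃, hδ₃, hδ₃'⟩ := Metric.isOpen_iff.1 isOpen_Ioo s₀ hs₀mem
      refine ⟨min δ₁ (min δ₂ δ₃), lt_min hδ₁ (lt_min hδ₂ hδ₃), fun l hlU hdist => ?_⟩
      have hg0 : g l₀ = 0 := if_neg (by rw [hzero]; exact lt_irrefl 0)
      rw [hg0]
      by_cases hl : 0 < l.im
      · rw [show g l = Φ l from if_pos hl, dist_zero_right]
        have hd1 : dist l l₀ < δ₁ := hdist.trans_le (min_le_left _ _)
        have hd2 : dist l l₀ < δ₂ := hdist.trans_le ((min_le_right _ _).trans (min_le_left _ _))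
        have hd3 : dist l l₀ < δ₃ := hdist.trans_le ((min_le_right _ _).trans (min_le_right _ _))
        have hre_le : dist l.re s₀ ≤ dist l l₀ := by
          rw [Real.dist_eq, dist_eq_norm, hs₀, ← sub_re]
          exact abs_re_le_norm (l - l₀)
        have him_le : dist l.im 0 ≤ dist l l₀ := by
          rw [Real.dist_eq, sub_zero, dist_eq_norm]
          have := abs_im_le_norm (l - l₀)
          rwa [sub_im, hzero, sub_zero] at this
        have hre_mem : l.re ∈ Ioo (-1 : ℝ) 1 := hδ₃' (hre_le.trans_lt hd3)
        have habs : |l.re| ≤ 1 := abs_le.2 ⟨hre_mem.1.le, hre_mem.2.le⟩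
        rw [hΦΛ hl habs]
        have ht_mem : l.im ∈ Ioc (0 : ℝ) 2 := ⟨hl, le_of_lt hlU.2⟩
        have hterm1 : ‖Λ l.im (τ l.re - τ s₀)‖ < ε / 2 :=
          (hC _ ht_mem _).trans_lt (hδ₂' (hre_le.trans_lt hd2))
        have hterm2 : ‖Λ l.im (τ s₀)‖ < ε / 2 := hδ₁' (him_le.trans_lt hd1) hl
        calc ‖Λ l.im (τ l.re)‖ = ‖Λ l.im (τ l.re - τ s₀) + Λ l.im (τ s₀)‖ := by
              rw [map_sub, sub_add_cancel]
          _ ≤ ‖Λ l.im (τ l.re - τ s₀)‖ + ‖Λ l.im (τ s₀)‖ := norm_add_le _ _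
          _ < ε / 2 + ε / 2 := add_lt_add hterm1 hterm2
          _ = ε := add_halves ε
      · rw [show g l = 0 from if_neg hl, dist_self]
        exact hε
    · exact ((hΦd hpos).continuousAt.congr (hg_pos hpos).symm).continuousWithinAt
  -- differentiability off the real axis, Painlevé, identity theorem
  have hgd : ∀ l ∈ U, l.im ≠ 0 → DifferentiableAt ℂ g l := by
    intro l _ hne
    rcases lt_or_gt_of_ne hne with hneg | hpos
    · exact (differentiableAt_const (0 : ℂ)).congr_of_eventuallyEq (hg_neg hneg)
    · exact (hΦd hpos).congr_of_eventuallyEq (hg_pos hpos)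
  have hgU : DifferentiableOn ℂ g U :=
    Complex.differentiableOn_of_continuousOn_of_differentiableAt_off_real hUo hgc hgd
  have hI : I ∈ U := ⟨by simp, by norm_num⟩
  have hnegI : -I ∈ U := ⟨by simp, by norm_num⟩
  have hzero : EqOn g 0 U :=
    (hgU.analyticOnNhd hUo).eqOn_zero_of_preconnected_of_eventuallyEq_zero hUc.isPreconnected
      hnegI (hg_neg (by norm_num))
  have h := hzero hI
  have hgI : g I = Φ I := if_pos (by norm_num)
  rw [hgI] at h
  exact h

/-! ### Rays in the time tube -/

/-- The time tube in terms of imaginary parts: real spatial coordinates and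
`Im z ∈ tubeCone d n`. [folklore] -/
theorem mem_timeTube_iff_imPart (z : Fin n → Fin (d + 1) → ℂ) :
    z ∈ timeTube d n ↔ (∀ (k : Fin n) (i : Fin d), (z k i.succ).im = 0) ∧
      (fun k => imPart (z k)) ∈ tubeCone d n := by
  constructor
  · intro hz
    exact ⟨hz.1, (mem_forwardTube_iff_imPart_mem_tubeCone z).1 (timeTube_subset_forwardTube hz)⟩
  · rintro ⟨hsp, hη⟩
    refine ⟨hsp, fun k => ?_⟩
    have h1 : (fun j => imPart (z j)) = fun j => (z j 0).im • e₀ d := by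
      funext j
      ext μ
      refine Fin.cases ?_ (fun i => ?_) μ
      · simp
      · simp [hsp j i, Fin.succ_ne_zero]
    have h := hη k
    rw [h1, succDiff_map (fun t : ℝ => t • e₀ d) (fun a b => sub_smul a b _),
      succDiff_map Complex.im Complex.sub_im, smul_e₀_mem_forwardCone_iff] at h
    exact h

/-- **Complex rays in temporal directions stay in the time tube**: for `η` in the temporal
cone and `Im λ > 0`, `x + λη ∈ timeTube d n` (complex times `x⁰_k + λ η⁰_k`, real space). [folklore] -/
theorem rayC_mem_timeTube (x : Fin n → SpaceTime d) {η : Fin n → SpaceTime d}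
    (hη : η ∈ temporalCone d n) {l : ℂ} (hl : 0 < l.im) : rayC x η l ∈ timeTube d n := by
  rw [mem_timeTube_iff_imPart]
  refine ⟨fun k i => by simp [rayC_apply, hη.2 k i], ?_⟩
  simp only [imPart_rayC]
  intro k
  rw [succDiff_map (fun v : SpaceTime d => l.im • v) (fun a b => smul_sub l.im a b)]
  exact smul_mem_forwardCone (hη.1 k) hl

/-- The complex ray in a temporal direction is obtained from the point `x + iη` of the time tube
by replacing the times: `withTimes (x + iη) (x⁰ + λη⁰) = x + λη`. [folklore] -/
theorem withTimes_rayC_I (x : Fin n → SpaceTime d) {η : Fin n → SpaceTime d}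
    (hη : η ∈ temporalCone d n) (l : ℂ) :
    withTimes (rayC x η I) (fun k => (x k 0 : ℂ) + l * (η k 0 : ℂ)) = rayC x η l := by
  funext k μ
  by_cases hμ : μ = 0
  · subst hμ
    simp [rayC_apply]
  · obtain ⟨i, rfl⟩ := Fin.exists_succ_eq.2 hμ
    simp [rayC_apply, hη.2 k i]

/-- Along a temporal complex ray a continuous function on the time tube is continuous in the base
point. [folklore] -/
theorem continuous_comp_rayC_of_continuousOn_timeTube {E : Type*} [TopologicalSpace E]
    {G : (Fin n → Fin (d + 1) → ℂ) → E} (hGc : ContinuousOn G (timeTube d n))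
    {η : Fin n → SpaceTime d} (hη : η ∈ temporalCone d n) {l : ℂ} (hl : 0 < l.im) :
    Continuous fun x : Fin n → SpaceTime d => G (rayC x η l) :=
  hGc.comp_continuous (continuous_rayC_left η l) fun x => rayC_mem_timeTube x hη hl

/-- Along a temporal complex ray a time-holomorphic function on the time tube is holomorphic in the
ray parameter on the upper half-plane. [folklore] -/
theorem differentiableOn_comp_rayC_of_isTimeHolomorphicOn {G : (Fin n → Fin (d + 1) → ℂ) → ℂ}
    (hGh : IsTimeHolomorphicOn G (timeTube d n)) {η : Fin n → SpaceTime d}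
    (hη : η ∈ temporalCone d n) (x : Fin n → SpaceTime d) :
    DifferentiableOn ℂ (fun l : ℂ => G (rayC x η l)) {l | 0 < l.im} := by
  have hz : rayC x η I ∈ timeTube d n := rayC_mem_timeTube x hη (by norm_num)
  have haff : Differentiable ℂ fun l : ℂ => fun k : Fin n => (x k 0 : ℂ) + l * (η k 0 : ℂ) :=
    differentiable_pi.2 fun k => (differentiable_const _).add (differentiable_id.mul_const _)
  have h := (hGh _ hz).comp haff.differentiableOn (fun l (hl : 0 < l.im) => by
    show withTimes (rayC x η I) (fun k => (x k 0 : ℂ) + l * (η k 0 : ℂ)) ∈ timeTube d n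
    rw [withTimes_rayC_I x hη l]
    exact rayC_mem_timeTube x hη hl)
  refine h.congr fun l _ => ?_
  simp only [Function.comp_apply, withTimes_rayC_I x hη l]

/-- A continuous function on the time tube is bounded on the rays `x + λη`, `x ∈ S`, `λ ∈ T`, for
`η` temporal, compact `S` and compact `T` in the open upper half-plane. [folklore] -/
theorem exists_bound_rayC_timeTube {E : Type*} [SeminormedAddCommGroup E]
    {f : (Fin n → Fin (d + 1) → ℂ) → E} (hf : ContinuousOn f (timeTube d n))
    {η : Fin n → SpaceTime d} (hη : η ∈ temporalCone d n)
    {S : Set (Fin n → SpaceTime d)} (hS : IsCompact S) {T : Set ℂ} (hT : IsCompact T)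
    (hT' : T ⊆ {l | 0 < l.im}) : ∃ M, ∀ x ∈ S, ∀ l ∈ T, ‖f (rayC x η l)‖ ≤ M := by
  have hc : IsCompact ((fun p : (Fin n → SpaceTime d) × ℂ => rayC p.1 η p.2) '' S ×ˢ T) :=
    (hS.prod hT).image (continuous_rayC η)
  have hsub :
      (fun p : (Fin n → SpaceTime d) × ℂ => rayC p.1 η p.2) '' S ×ˢ T ⊆ timeTube d n := by
    rintro _ ⟨p, hp, rfl⟩
    exact rayC_mem_timeTube p.1 hη (hT' hp.2)
  obtain ⟨M, hM⟩ := hc.exists_bound_of_continuousOn (hf.mono hsub)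
  exact ⟨M, fun x hx l hl => hM _ ⟨(x, l), ⟨hx, hl⟩, rfl⟩⟩

/-- **Holomorphy of the smeared ray function for a time-holomorphic function**: for `G`
continuous on the time tube and holomorphic in the times, `η` temporal and `φ` continuous of
compact support, `λ ↦ ∫ G(x + λη) φ(x) dx` is complex differentiable on `Im λ > 0` — holomorphy
of dominated parameter integrals, the majorant coming from the continuity of `G` on the compact
family of rays (`Literature.Analysis.Complex.differentiableOn_integral_of_dominated`; no
derivative bound is needed). [folklore] -/
theorem differentiableAt_integral_rayC_of_isTimeHolomorphicOn {G : (Fin n → Fin (d + 1) → ℂ) → ℂ}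
    (hGc : ContinuousOn G (timeTube d n)) (hGh : IsTimeHolomorphicOn G (timeTube d n))
    {η : Fin n → SpaceTime d} (hη : η ∈ temporalCone d n)
    {φ : (Fin n → SpaceTime d) → ℂ} (hφ : Continuous φ) (hφc : HasCompactSupport φ) {l₀ : ℂ}
    (hl₀ : 0 < l₀.im) :
    DifferentiableAt ℂ (fun l => ∫ x, G (rayC x η l) * φ x) l₀ := by
  have hopen : IsOpen {l : ℂ | 0 < l.im} := isOpen_lt continuous_const continuous_im
  have hd : DifferentiableOn ℂ (fun l => ∫ x, G (rayC x η l) * φ x) {l : ℂ | 0 < l.im} := by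
    refine Literature.Analysis.Complex.differentiableOn_integral_of_dominated
      (F := fun l x => G (rayC x η l) * φ x) (μ := volume) ?_ ?_ ?_
    · intro l hl
      exact ((continuous_comp_rayC_of_continuousOn_timeTube hGc hη hl).mul hφ).aestronglyMeasurable
    · exact Eventually.of_forall fun x =>
        (differentiableOn_comp_rayC_of_isTimeHolomorphicOn hGh hη x).mul (differentiableOn_const _)
    · intro l₁ hl₁
      have hl₁' : 0 < l₁.im := hl₁
      refine ⟨l₁.im / 2, half_pos hl₁', fun l hl => ?_, ?_⟩
      · have h1 : |l.im - l₁.im| < l₁.im / 2 := by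
          have := abs_im_le_norm (l - l₁)
          rw [sub_im] at this
          exact this.trans_lt (mem_ball_iff_norm.1 hl)
        have h2 := (abs_lt.1 h1).1
        show 0 < l.im
        linarith
      · have hT' : Metric.closedBall l₁ (l₁.im / 2) ⊆ {l : ℂ | 0 < l.im} := by
          intro l hl
          have h1 : |l.im - l₁.im| ≤ l₁.im / 2 := by
            have := abs_im_le_norm (l - l₁)
            rw [sub_im] at this
            exact this.trans (mem_closedBall_iff_norm.1 hl)
          have h2 := (abs_le.1 h1).1
          show 0 < l.im
          linarith
        obtain ⟨M, hM⟩ := exists_bound_rayC_timeTube hGc hη hφc.isCompact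
          (isCompact_closedBall l₁ (l₁.im / 2)) hT'
        refine ⟨fun x => M * ‖φ x‖,
          (continuous_const.mul hφ.norm).integrable_of_hasCompactSupport hφc.norm.mul_left,
          Eventually.of_forall fun x l hl => ?_⟩
        by_cases hx : x ∈ tsupport φ
        · rw [norm_mul]
          exact mul_le_mul_of_nonneg_right (hM x hx l (Metric.ball_subset_closedBall hl))
            (norm_nonneg _)
        · have h0 : φ x = 0 := image_eq_zero_of_notMem_tsupport hx
          simp [h0]
  exact hd.differentiableAt (hopen.mem_nhds hl₀)

/-! ### Uniqueness of time-ray boundary values on the time tube -/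

/-- **A continuous, time-holomorphic function on the time tube all of whose time-ray boundary
values on compactly supported test functions vanish is zero** (Streater–Wightman (1964),
Thm. 2-17 / Hörmander Thm. 3.1.15, in the time variables: through `z = x + iy` in the time tube
passes the complex ray `x + λy` in the *temporal* direction `y = Im z`, which stays in the time
tube for `Im λ > 0` and along which `G` is holomorphic in `λ`; the core
`integral_rayC_I_mul_eq_zero_of_continuous` gives `∫ G(x + iy) φ(x) dx = 0` for all `φ`, and
`G(· + iy)` is continuous). [cite: StreaterWightman1964, Thm 2-17] -/
theorem eq_zero_of_timeRayBoundaryValue_zero {G : (Fin n → Fin (d + 1) → ℂ) → ℂ}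
    (hGc : ContinuousOn G (timeTube d n)) (hGh : IsTimeHolomorphicOn G (timeTube d n))
    (hlim : ∀ η ∈ temporalCone d n, ∀ F : 𝓢((Fin n → SpaceTime d), ℂ),
      HasCompactSupport (F : (Fin n → SpaceTime d) → ℂ) →
      Tendsto (fun t : ℝ => ∫ x : Fin n → SpaceTime d,
        G (fun k => complexifyPoint (x k) + ((t : ℂ) * I) • complexifyPoint (η k)) * F x)
        (𝓝[>] 0) (𝓝 0))
    {z : Fin n → Fin (d + 1) → ℂ} (hz : z ∈ timeTube d n) : G z = 0 := by
  set η := fun k => imPart (z k) with hη_def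
  have hy : η ∈ temporalCone d n := by
    refine ⟨((mem_timeTube_iff_imPart z).1 hz).2, fun k i => ?_⟩
    simp only [hη_def, imPart_apply]
    exact hz.1 k i
  have key : ∀ x : Fin n → SpaceTime d, G (rayC x η I) = 0 := by
    have hlimη : ∀ F : 𝓢((Fin n → SpaceTime d), ℂ),
        HasCompactSupport (F : (Fin n → SpaceTime d) → ℂ) →
        Tendsto (fun t : ℝ => ∫ x, G (rayC x η ((t : ℂ) * I)) * F x) (𝓝[>] 0) (𝓝 0) :=
      fun F hF => hlim η hy F hF
    have hD : ∀ φ : (Fin n → SpaceTime d) → ℂ, ContDiff ℝ ∞ φ → HasCompactSupport φ →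
        ∫ x, G (rayC x η I) * φ x = 0 :=
      fun φ hφ hφc => integral_rayC_I_mul_eq_zero_of_continuous
        (fun hl => continuous_comp_rayC_of_continuousOn_timeTube hGc hy hl)
        (fun hφ' hφc' _ hl₀ =>
          differentiableAt_integral_rayC_of_isTimeHolomorphicOn hGc hGh hy hφ' hφc' hl₀)
        hlimη hφ hφc
    have hcont : Continuous fun x : Fin n → SpaceTime d => G (rayC x η I) :=
      continuous_comp_rayC_of_continuousOn_timeTube hGc hy (by norm_num)
    have hae : ∀ᵐ x ∂(volume : Measure (Fin n → SpaceTime d)), G (rayC x η I) = 0 := by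
      refine ae_eq_zero_of_integral_contDiff_smul_eq_zero hcont.locallyIntegrable
        fun g hg hgc => ?_
      have h := hD (fun x => (g x : ℂ)) (ofRealCLM.contDiff.comp hg) (hgc.comp_left ofReal_zero)
      rw [← h]
      congr 1
      funext x
      rw [real_smul, mul_comm]
    have heq := (hcont.ae_eq_iff_eq volume continuous_const).1 hae
    exact fun x => congrFun heq x
  have h := key fun k => rePart (z k)
  rwa [hη_def, rayC_rePart_imPart] at h

/-- **Discharge of (D) `eqOn_timeTube_of_timeRayBoundaryValue`**: two functions continuous on the
time tube, holomorphic in the times, with the same time-ray boundary value coincide on the time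
tube — apply `eq_zero_of_timeRayBoundaryValue_zero` to the difference (along each ray with `t > 0`
both integrands are continuous of compact support, so the integral of the difference is the
difference of the integrals, which tends to `T(F) − T(F) = 0`). [cite: StreaterWightman1964, Thm 2-17] -/
theorem eqOn_timeTube_of_timeRayBoundaryValue_holds : eqOn_timeTube_of_timeRayBoundaryValue := by
  intro d n 𝔚 𝔚' T hc hh hc' hh' hbv hbv' z hz
  have hsub : (fun w => 𝔚 w - 𝔚' w) z = 0 := by
    refine eq_zero_of_timeRayBoundaryValue_zero (G := fun w => 𝔚 w - 𝔚' w) (hc.sub hc')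
      (fun w hw => (hh w hw).sub (hh' w hw)) (fun η hη F hF => ?_) hz
    have h := (hbv η hη F).sub (hbv' η hη F)
    rw [sub_self] at h
    refine h.congr' ?_
    filter_upwards [self_mem_nhdsWithin] with t (ht : 0 < t)
    have hIt : 0 < ((t : ℂ) * I).im := by simpa using ht
    have hint : ∀ {H : (Fin n → Fin (d + 1) → ℂ) → ℂ}, ContinuousOn H (timeTube d n) →
        Integrable fun x : Fin n → SpaceTime d => H (rayC x η ((t : ℂ) * I)) * F x :=
      fun hH => ((continuous_comp_rayC_of_continuousOn_timeTube hH hη hIt).mul F.continuous)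
        |>.integrable_of_hasCompactSupport hF.mul_left
    change (∫ x, 𝔚 (rayC x η ((t : ℂ) * I)) * F x) - ∫ x, 𝔚' (rayC x η ((t : ℂ) * I)) * F x =
      ∫ x, (𝔚 (rayC x η ((t : ℂ) * I)) - 𝔚' (rayC x η ((t : ℂ) * I))) * F x
    rw [← integral_sub (hint hc) (hint hc')]
    congr 1
    funext x
    ring
  exact sub_eq_zero.1 hsub

/-- **(A₁₂⁺) from (A1), (A2), (B) alone**, (D) being a theorem
(`eqOn_timeTube_of_timeRayBoundaryValue_holds`). Real proof. [cite: OsterwalderSchraderCMP1975, §IV.2 pp. 288–289] -/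
theorem OS1975_exists_continuation_halfSpace_of_timeContinuation'
    (hA1 : OS1975_exists_timeContinuation) (hA2 : OS1975_boundaryValue_of_timeContinuation)
    (hB : OS1973_lorentzInvariant_of_timeContinuation) : OS1975_exists_continuation_halfSpace :=
  OS1975_exists_continuation_halfSpace_of_timeContinuation hA1 hA2 hB
    eqOn_timeTube_of_timeRayBoundaryValue_holds

/-- **(A₁₂) from (A1), (A2), (B) alone.** Real proof. [cite: OsterwalderSchraderCMP1975, §IV.2 pp. 288–289] -/
theorem OS1975_exists_forwardTube_continuation_of_timeContinuation'
    (hA1 : OS1975_exists_timeContinuation) (hA2 : OS1975_boundaryValue_of_timeContinuation)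
    (hB : OS1973_lorentzInvariant_of_timeContinuation) : OS1975_exists_forwardTube_continuation :=
  OS1975_exists_forwardTube_continuation_of_timeContinuation hA1 hA2 hB
    eqOn_timeTube_of_timeRayBoundaryValue_holds

/-- **`os_reconstruction` from (A1), (A2), (B), locality, positivity and the cluster property.**
Real proof. [cite: OsterwalderSchraderCMP1975, §IV.1 Thm. E'→R'] -/
theorem os_reconstruction_of_timeContinuation'
    (hA1 : OS1975_exists_timeContinuation) (hA2 : OS1975_boundaryValue_of_timeContinuation)
    (hB : OS1973_lorentzInvariant_of_timeContinuation)
    (hR3 : OS1973_local) (hR2 : OS1973_positiveDefinite) (hR4 : OS1973_cluster) :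
    os_reconstruction :=
  os_reconstruction_of_timeContinuation hA1 hA2 hB eqOn_timeTube_of_timeRayBoundaryValue_holds
    hR3 hR2 hR4

end Literature.MathematicalPhysics.QuantumFieldTheory
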